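import Mathlib
import HarnessLib
import Summits.ResolutionOfSingularities.ResolutionOfSingularities.Theorems.WildQuotientsWildQuotientResolutionS1aTranslationTerminal

/-!
# S1a — THE TRANSLATION CLASS in census coordinates: `σ x_n = x_n + F(x₀,…,x_{n−1})` on `k[x₀,…,x_n]` is TERMINAL AT MOVE 0

[OURS · L1 W4.5c · leafhand-res-wildquotients-9 g1; SUCCESSOR-BRIEF-v2 §3 caveat E-T, ADDENDUM v2d (`r = 0` translation type)] — NOT statements
of the manuscript; counted 0; AI-level work, weaker than expert review. Crux stmt-ResolutionOfSingularities-17941 `CyclicQuotientFourfolds`, line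
`s1a-logminvertex` v13 (`stub_reachLowerInFX`). A CLASS of the research stub, not the stub.

The `MvPolynomial` form of ✓`translation_terminal_initial` (`…S1aTranslationTerminal`, chart `Γ(X′, ⊤) ≃+* R[X]`), in the coordinates of the
census theorems (`e : Γ(X′, ⊤) ≃+* k[x_0,…,x_n]` intertwining `g₀` with `σ`):
* `translationMv_terminal_initial` — `σ` a ring endomorphism of `k[x_0,…,x_n]` (`k` a field of characteristic `p`) fixing constants and
  `x_0,…,x_{n−1}` and translating the LAST variable `x_n ↦ x_n + F(x_0,…,x_{n−1})` ⇒ the initial model is TERMINAL (transport along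
  `k[x_0,…,x_n] ≃ₐ k[x_0,…,x_{n−1}][X]`, Mathlib `renameEquiv finSuccEquivLast ≫ optionEquivLeft`);
* `exists_reachLowerF_initial_of_translationMv` — hence the conclusion of `ReachLowerInF(X)` at the initial model, every root decoration;
* `x3Translation_terminal_initial`, `exists_reachLowerF_initial_of_x3Translation` — the four-variable census shape
  `x₀, x₁, x₂ ↦ themselves, x₃ ↦ x₃ + F(x₀, x₁, x₂)` (any `F`, every `p`): TERMINAL at move `0` / inhabits the research stub with the empty tree,
  although `Fix(σ) = {F = 0}` is a surface (caveat E-T).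
-/

set_option linter.dupNamespace false

noncomputable section

open CategoryTheory Limits AlgebraicGeometry TopologicalSpace Topology MvPolynomial
open Literature.AlgebraicGeometry.Resolution Literature.AlgebraicGeometry.RelativeSpec
open Summit.ResolutionOfSingularities.ResolutionOfSingularities.Theorems.WildQuotientResolution.S1
open Summit.ResolutionOfSingularities.ResolutionOfSingularities.Theorems.WildQuotientResolution.S1.NodeAtlas
open Summit.ResolutionOfSingularities.ResolutionOfSingularities.Theorems.WildQuotientResolution.S1.NpFrame

namespace Summit.ResolutionOfSingularities.ResolutionOfSingularities.Theorems.WildQuotientResolution.S1.GameFrame.GModel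

variable {p : ℕ} {X' X₁ : Scheme.{0}} {q : X' ⟶ X₁} {G : Type} [Group G] {ρ : G →* Aut X'} {g₀ : G}

/-- ★★ **TRANSLATION OF THE LAST VARIABLE IS TERMINAL AT MOVE 0.** Let `(X′, X₁, q, ρ, g₀)` be action data with `X′` AFFINE, integral and locally
Noetherian, `q` affine and `G`-invariant, `G = ⟨g₀⟩`; let `e : Γ(X′, ⊤) ≃+* k[x_0,…,x_n]` (`k` a field of characteristic `p`) intertwine the
action of `g₀` (pull-back along `g₀⁻¹`) with a ring endomorphism `σ` fixing constants and `x_0,…,x_{n−1}` and translating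
`x_n ↦ x_n + F(x_0,…,x_{n−1})`. Then the INITIAL MODEL IS TERMINAL (ring of invariants `≅ k[x_0,…,x_{n−1}][N]`, `N = x_n^p − F^{p−1}x_n`, regular).
[OURS · L1 W4.5c · class `r = 0` translation; NOT a statement of the manuscript] -/
theorem translationMv_terminal_initial [Finite G] (hG : ∀ g : G, g ∈ Subgroup.zpowers g₀)
    (hq : ∀ g : G, (ρ g).hom ≫ q = q) [IsIntegral X'] [IsLocallyNoetherian X'] [IsAffine X'] [IsAffineHom q]
    {k : Type} [Field k] [CharP k p] (hp : p.Prime) (n : ℕ) (F : MvPolynomial (Fin n) k)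
    (σ : MvPolynomial (Fin (n + 1)) k →+* MvPolynomial (Fin (n + 1)) k) (hC : ∀ a : k, σ (C a) = C a)
    (hfix : ∀ i : Fin n, σ (X (Fin.castSucc i)) = X (Fin.castSucc i))
    (hlast : σ (X (Fin.last n)) = X (Fin.last n) + rename Fin.castSucc F)
    (e : Γ(X', ⊤) ≃+* MvPolynomial (Fin (n + 1)) k)
    (he : ∀ t : Γ(X', ⊤), e ((ρ g₀⁻¹).hom.appLE ⊤ ⊤ (by rw [Scheme.Hom.preimage_top]) t) = σ (e t))
    (h₀ : NodeAtlas p (⟨ρ, hq⟩ : ActionOver q G) g₀) :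
    (GModel.initial (p := p) (g₀ := g₀) hq h₀).Terminal := by
  -- `ψ : k[x_0,…,x_n] ≃ k[x_0,…,x_{n-1}][X]`, `x_n ↦ X`, `x_i ↦ C x_i`
  let ψ : MvPolynomial (Fin (n + 1)) k ≃ₐ[k] Polynomial (MvPolynomial (Fin n) k) :=
    (renameEquiv k (finSuccEquivLast (n := n))).trans (optionEquivLeft k (Fin n))
  have hψlast : ψ (X (Fin.last n)) = Polynomial.X := by
    simp [ψ, renameEquiv_apply, rename_X, finSuccEquivLast_last, optionEquivLeft_X_none]
  have hψsucc : ∀ i : Fin n, ψ (X (Fin.castSucc i)) = Polynomial.C (X i) := fun i => by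
    simp [ψ, renameEquiv_apply, rename_X, finSuccEquivLast_castSucc, optionEquivLeft_X_some]
  have hψC : ∀ a : k, ψ (C a) = Polynomial.C (C a) := fun a => by
    simp [ψ, renameEquiv_apply, optionEquivLeft_C]
  -- `ψ ∘ rename castSucc = C` and `σ ∘ rename castSucc = rename castSucc`
  have hψren : ∀ r : MvPolynomial (Fin n) k, ψ (rename Fin.castSucc r) = Polynomial.C r := by
    intro r
    have h : (ψ : MvPolynomial (Fin (n + 1)) k →+* Polynomial (MvPolynomial (Fin n) k)).comp
        (rename Fin.castSucc : MvPolynomial (Fin n) k →ₐ[k] MvPolynomial (Fin (n + 1)) k) = Polynomial.C := by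
      refine MvPolynomial.ringHom_ext (fun a => ?_) (fun i => ?_)
      · simp only [RingHom.coe_comp, RingHom.coe_coe, Function.comp_apply, rename_C]
        exact hψC a
      · simp only [RingHom.coe_comp, RingHom.coe_coe, Function.comp_apply, rename_X]
        exact hψsucc i
    exact DFunLike.congr_fun h r
  have hσren : ∀ r : MvPolynomial (Fin n) k, σ (rename Fin.castSucc r) = rename Fin.castSucc r := by
    intro r
    have h : σ.comp ((rename Fin.castSucc : MvPolynomial (Fin n) k →ₐ[k] MvPolynomial (Fin (n + 1)) k) :
          MvPolynomial (Fin n) k →+* MvPolynomial (Fin (n + 1)) k) =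
        ((rename Fin.castSucc : MvPolynomial (Fin n) k →ₐ[k] MvPolynomial (Fin (n + 1)) k) :
          MvPolynomial (Fin n) k →+* MvPolynomial (Fin (n + 1)) k) := by
      refine MvPolynomial.ringHom_ext (fun a => ?_) (fun i => ?_)
      · simp only [RingHom.coe_comp, RingHom.coe_coe, Function.comp_apply, rename_C]
        exact hC a
      · simp only [RingHom.coe_comp, RingHom.coe_coe, Function.comp_apply, rename_X]
        exact hfix i
    exact DFunLike.congr_fun h r
  -- the transported endomorphism `σ₀ = ψ ∘ σ ∘ ψ⁻¹` of `k[x_0,…,x_{n-1}][X]`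
  let σ₀ : Polynomial (MvPolynomial (Fin n) k) →+* Polynomial (MvPolynomial (Fin n) k) :=
    ((ψ : MvPolynomial (Fin (n + 1)) k →+* Polynomial (MvPolynomial (Fin n) k)).comp σ).comp
      (ψ.symm : Polynomial (MvPolynomial (Fin n) k) →+* MvPolynomial (Fin (n + 1)) k)
  have hσ₀ : ∀ y, σ₀ y = ψ (σ (ψ.symm y)) := fun _ => rfl
  have hC₀ : ∀ r : MvPolynomial (Fin n) k, σ₀ (Polynomial.C r) = Polynomial.C r := fun r => by
    rw [hσ₀, show ψ.symm (Polynomial.C r) = rename Fin.castSucc r by rw [← hψren, ψ.symm_apply_apply], hσren, hψren]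
  have hX₀ : σ₀ Polynomial.X = Polynomial.X + Polynomial.C F := by
    rw [hσ₀, show ψ.symm Polynomial.X = X (Fin.last n) by rw [← hψlast, ψ.symm_apply_apply], hlast, map_add, hψlast, hψren]
  refine translation_terminal_initial (p := p) hG hq hp F σ₀ hC₀ hX₀ (e.trans (ψ : MvPolynomial (Fin (n + 1)) k ≃+* _)) (fun t => ?_) h₀
  change ψ (e _) = ψ (σ (ψ.symm (ψ (e t))))
  rw [he, ψ.symm_apply_apply]

/-- ★ **… hence inhabits the research stub at depth 0** (every root decoration). [OURS · L1 W4.5c · class `r = 0` translation; NOT a statement of the manuscript] -/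
theorem exists_reachLowerF_initial_of_translationMv [Finite G] (hG : ∀ g : G, g ∈ Subgroup.zpowers g₀)
    (hq : ∀ g : G, (ρ g).hom ≫ q = q) [IsIntegral X'] [IsLocallyNoetherian X'] [IsAffine X'] [IsAffineHom q]
    {k : Type} [Field k] [CharP k p] (hp : p.Prime) (n : ℕ) (F : MvPolynomial (Fin n) k)
    (σ : MvPolynomial (Fin (n + 1)) k →+* MvPolynomial (Fin (n + 1)) k) (hC : ∀ a : k, σ (C a) = C a)
    (hfix : ∀ i : Fin n, σ (X (Fin.castSucc i)) = X (Fin.castSucc i))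
    (hlast : σ (X (Fin.last n)) = X (Fin.last n) + rename Fin.castSucc F)
    (e : Γ(X', ⊤) ≃+* MvPolynomial (Fin (n + 1)) k)
    (he : ∀ t : Γ(X', ⊤), e ((ρ g₀⁻¹).hom.appLE ⊤ ⊤ (by rw [Scheme.Hom.preimage_top]) t) = σ (e t))
    (h₀ : NodeAtlas p (⟨ρ, hq⟩ : ActionOver q G) g₀) (𝔄₀ : NodeAtlasData p (GModel.initial hq h₀).act g₀) :
    ∃ P : ∀ M : GModel p q G ρ g₀, NodeAtlasData p M.act g₀ → Prop,
      P (GModel.initial hq h₀) 𝔄₀ ∧ ∀ (M : GModel p q G ρ g₀) (𝔄 : NodeAtlasData p M.act g₀), P M 𝔄 → ¬ M.Terminal →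
        ∃ n : ℕ, TreeF P (fun N 𝔅 => LexLTF N 𝔅 M 𝔄) n M 𝔄 :=
  exists_reachLowerF_of_terminal _ 𝔄₀ (translationMv_terminal_initial hG hq hp n F σ hC hfix hlast e he h₀)

/-- ★★ **THE CENSUS SHAPE: `x₃ ↦ x₃ + F(x₀, x₁, x₂)` IS TERMINAL AT MOVE 0** (four variables, `x₀, x₁, x₂` fixed, any `F ∈ k[x₀, x₁, x₂]`, every `p`).
[OURS · L1 W4.5c · class `r = 0` translation / caveat E-T; NOT a statement of the manuscript] -/
theorem x3Translation_terminal_initial [Finite G] (hG : ∀ g : G, g ∈ Subgroup.zpowers g₀)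
    (hq : ∀ g : G, (ρ g).hom ≫ q = q) [IsIntegral X'] [IsLocallyNoetherian X'] [IsAffine X'] [IsAffineHom q]
    {k : Type} [Field k] [CharP k p] (hp : p.Prime) (F : MvPolynomial (Fin 3) k)
    (σ : MvPolynomial (Fin 4) k →+* MvPolynomial (Fin 4) k) (hC : ∀ a : k, σ (C a) = C a)
    (h0 : σ (X 0) = X 0) (h1 : σ (X 1) = X 1) (h2 : σ (X 2) = X 2) (h3 : σ (X 3) = X 3 + rename Fin.castSucc F)
    (e : Γ(X', ⊤) ≃+* MvPolynomial (Fin 4) k)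
    (he : ∀ t : Γ(X', ⊤), e ((ρ g₀⁻¹).hom.appLE ⊤ ⊤ (by rw [Scheme.Hom.preimage_top]) t) = σ (e t))
    (h₀ : NodeAtlas p (⟨ρ, hq⟩ : ActionOver q G) g₀) :
    (GModel.initial (p := p) (g₀ := g₀) hq h₀).Terminal := by
  refine translationMv_terminal_initial (p := p) hG hq hp 3 F σ hC (fun i => ?_) h3 e he h₀
  fin_cases i
  · exact h0
  · exact h1
  · exact h2

/-- ★ **… and inhabits the research stub at depth 0** (every root decoration). [OURS · L1 W4.5c · class `r = 0` translation; NOT a statement of the manuscript] -/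
theorem exists_reachLowerF_initial_of_x3Translation [Finite G] (hG : ∀ g : G, g ∈ Subgroup.zpowers g₀)
    (hq : ∀ g : G, (ρ g).hom ≫ q = q) [IsIntegral X'] [IsLocallyNoetherian X'] [IsAffine X'] [IsAffineHom q]
    {k : Type} [Field k] [CharP k p] (hp : p.Prime) (F : MvPolynomial (Fin 3) k)
    (σ : MvPolynomial (Fin 4) k →+* MvPolynomial (Fin 4) k) (hC : ∀ a : k, σ (C a) = C a)
    (h0 : σ (X 0) = X 0) (h1 : σ (X 1) = X 1) (h2 : σ (X 2) = X 2) (h3 : σ (X 3) = X 3 + rename Fin.castSucc F)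
    (e : Γ(X', ⊤) ≃+* MvPolynomial (Fin 4) k)
    (he : ∀ t : Γ(X', ⊤), e ((ρ g₀⁻¹).hom.appLE ⊤ ⊤ (by rw [Scheme.Hom.preimage_top]) t) = σ (e t))
    (h₀ : NodeAtlas p (⟨ρ, hq⟩ : ActionOver q G) g₀) (𝔄₀ : NodeAtlasData p (GModel.initial hq h₀).act g₀) :
    ∃ P : ∀ M : GModel p q G ρ g₀, NodeAtlasData p M.act g₀ → Prop,
      P (GModel.initial hq h₀) 𝔄₀ ∧ ∀ (M : GModel p q G ρ g₀) (𝔄 : NodeAtlasData p M.act g₀), P M 𝔄 → ¬ M.Terminal →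
        ∃ n : ℕ, TreeF P (fun N 𝔅 => LexLTF N 𝔅 M 𝔄) n M 𝔄 :=
  exists_reachLowerF_of_terminal _ 𝔄₀ (x3Translation_terminal_initial hG hq hp F σ hC h0 h1 h2 h3 e he h₀)

/-! ## Appendix (leafhand-res-wildquotients-9 g1, same session): RANK-2 TRANSLATIONS WITH PRINCIPAL DIRECTION IDEAL are TERMINAL AT MOVE 0 (the end state of the `r = 0` translation stratum)

[OURS · L1 W4.5c · leafhand-res-wildquotients-9 g1; SUCCESSOR-BRIEF-v2 ADDENDUM v2f REV d §7.2 («translation-type r = 0 germs … that stratum = σ̄-equivariant dim-3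
principalization of Artin–Schreier-shaped ideals») and caveat E-T] — NOT statements of the manuscript; counted 0; AI-level work, weaker than expert review. Crux
stmt-ResolutionOfSingularities-17941 `CyclicQuotientFourfolds`, line `s1a-logminvertex` v13 (`stub_reachLowerInFX`). A CLASS of the research stub, not the stub.

THE `r = 0` TRANSLATION STRATUM in four variables: `σ xᵢ = xᵢ + Fᵢ` with every `Fᵢ` INVARIANT. With two fixed variables `x₀, x₁` and two moving ones,
`σ x₂ = x₂ + F(x₀,x₁)`, `σ x₃ = x₃ + G(x₀,x₁)`, the augmentation ideal is `(F, G)·k[x]` and by Király–Lütkebohmert the quotient is regular exactly where the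
DIRECTION IDEAL `(F, G) ⊆ k[x₀, x₁]` is invertible; the game on this stratum is the (equivariant for free, `σ` being trivial on `k[x₀,x₁]`) principalization of
`(F, G)` by blow-ups of the plane. This file is the END-STATE RECOGNITION: when `(F, G) = (H)` is PRINCIPAL — written in Bézout form `F = H f′`, `G = H g′`,
`α f′ + β g′ = 1` (equivalent for `H ≠ 0` in a domain) — the unimodular recoordination `y = α x₂ + β x₃`, `z = g′ x₂ − f′ x₃` (determinant `−1`) turns `σ` into the
RANK-1 translation `y ↦ y + H`, `z ↦ z`, which is TERMINAL by ✓`x3Translation_terminal_initial` (`…S1aTranslationTerminalMv`: Artin–Schreier invariants `k[x₀,x₁,z][N_H(y)]`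
regular).
* `translationRankTwo_terminal_initial` — the class theorem (census coordinates `e : Γ(X′, ⊤) ≃+* k[x₀,…,x₃]`, every `p`, every `H, f′, g′, α, β ∈ k[x₀,x₁]` with
  `α f′ + β g′ = 1`);
* `exists_reachLowerF_initial_of_translationRankTwo` — hence the conclusion of `ReachLowerInF(X)` at the initial model, every root decoration (empty tree).
The GENUINE residual of the stratum (not claimed): `(F, G)` NOT principal, e.g. `(F, G) = (x₀, x₁)` — which is the LINEAR germ `J₂ ⊕ J₂` (✓`linear_killsIn_one`, one
move = one point blow-up principalizing `(x₀, x₁)`) — and in general `KillsIn (number of plane blow-ups principalizing (F, G))`, a classical finite process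
(Zariski) still to be typed as game moves.
-/

set_option maxHeartbeats 400000 in
/-- ★★ **RANK-2 TRANSLATIONS WITH PRINCIPAL DIRECTION IDEAL ARE TERMINAL AT MOVE 0.** Let `(X′, X₁, q, ρ, g₀)` be action data with `X′` AFFINE,
integral, locally Noetherian, `q` affine and `G`-invariant, `G = ⟨g₀⟩`; let `e : Γ(X′, ⊤) ≃+* k[x₀,…,x₃]` (`k` a field of characteristic `p`) intertwine `g₀`
with a ring endomorphism `σ` fixing constants and `x₀, x₁` and translating `x₂ ↦ x₂ + ε(H f′)`, `x₃ ↦ x₃ + ε(H g′)` for `H, f′, g′ ∈ k[x₀, x₁]`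
(`ε : k[x₀,x₁] → k[x₀,…,x₃]` the inclusion) with `α f′ + β g′ = 1` for some `α, β ∈ k[x₀, x₁]` — i.e. the direction ideal `(F, G) = (H)` is PRINCIPAL.
Then the INITIAL MODEL IS TERMINAL. [OURS · L1 W4.5c · class `r = 0` translation, rank 2, principal direction; NOT a statement of the manuscript] -/
theorem translationRankTwo_terminal_initial [Finite G] (hG : ∀ g : G, g ∈ Subgroup.zpowers g₀)
    (hq : ∀ g : G, (ρ g).hom ≫ q = q) [IsIntegral X'] [IsLocallyNoetherian X'] [IsAffine X'] [IsAffineHom q]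
    {k : Type} [Field k] [CharP k p] (hp : p.Prime) (H f' g' α β : MvPolynomial (Fin 2) k) (hbez : α * f' + β * g' = 1)
    (σ : MvPolynomial (Fin 4) k →+* MvPolynomial (Fin 4) k) (hC : ∀ a : k, σ (C a) = C a)
    (h0 : σ (X 0) = X 0) (h1 : σ (X 1) = X 1)
    (h2 : σ (X 2) = X 2 + rename (Fin.castLE (by decide : 2 ≤ 4)) (H * f'))
    (h3 : σ (X 3) = X 3 + rename (Fin.castLE (by decide : 2 ≤ 4)) (H * g'))
    (e : Γ(X', ⊤) ≃+* MvPolynomial (Fin 4) k)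
    (he : ∀ t : Γ(X', ⊤), e ((ρ g₀⁻¹).hom.appLE ⊤ ⊤ (by rw [Scheme.Hom.preimage_top]) t) = σ (e t))
    (h₀ : NodeAtlas p (⟨ρ, hq⟩ : ActionOver q G) g₀) :
    (GModel.initial (p := p) (g₀ := g₀) hq h₀).Terminal := by
  -- the inclusion `ε : k[x₀,x₁] → k[x₀,…,x₃]` and its image is fixed by `σ`
  let ε : MvPolynomial (Fin 2) k →ₐ[k] MvPolynomial (Fin 4) k := rename (Fin.castLE (by decide : 2 ≤ 4))
  have hε0 : ε (X 0) = X 0 := by simp only [ε, rename_X]; rfl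
  have hε1 : ε (X 1) = X 1 := by simp only [ε, rename_X]; rfl
  have hσε : ∀ r : MvPolynomial (Fin 2) k, σ (ε r) = ε r := by
    intro r
    have h : σ.comp (ε : MvPolynomial (Fin 2) k →+* MvPolynomial (Fin 4) k) = (ε : MvPolynomial (Fin 2) k →+* MvPolynomial (Fin 4) k) := by
      refine MvPolynomial.ringHom_ext (fun a => ?_) (fun i => ?_)
      · simp only [RingHom.coe_comp, RingHom.coe_coe, Function.comp_apply, ε, rename_C]; exact hC a
      · fin_cases i
        · simp only [RingHom.coe_comp, RingHom.coe_coe, Function.comp_apply]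
          change σ (ε (X 0)) = ε (X 0); rw [hε0, h0]
        · simp only [RingHom.coe_comp, RingHom.coe_coe, Function.comp_apply]
          change σ (ε (X 1)) = ε (X 1); rw [hε1, h1]
    exact DFunLike.congr_fun h r
  have hbez' : ε α * ε f' + ε β * ε g' = 1 := by
    rw [← map_mul, ← map_mul, ← map_add, hbez, map_one]
  -- the unimodular recoordination `Φ`: x₂ ↦ z = g′x₂ − f′x₃, x₃ ↦ y = αx₂ + βx₃ (and its inverse)
  let Φ₁ : MvPolynomial (Fin 4) k →ₐ[k] MvPolynomial (Fin 4) k :=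
    aeval ![X 0, X 1, ε g' * X 2 - ε f' * X 3, ε α * X 2 + ε β * X 3]
  let Φ₂ : MvPolynomial (Fin 4) k →ₐ[k] MvPolynomial (Fin 4) k :=
    aeval ![X 0, X 1, ε f' * X 3 + ε β * X 2, ε g' * X 3 - ε α * X 2]
  have hΦ₁0 : Φ₁ (X 0) = X 0 := by simp only [Φ₁, aeval_X]; rfl
  have hΦ₁1 : Φ₁ (X 1) = X 1 := by simp only [Φ₁, aeval_X]; rfl
  have hΦ₁2 : Φ₁ (X 2) = ε g' * X 2 - ε f' * X 3 := by simp only [Φ₁, aeval_X]; rfl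
  have hΦ₁3 : Φ₁ (X 3) = ε α * X 2 + ε β * X 3 := by simp only [Φ₁, aeval_X]; rfl
  have hΦ₂0 : Φ₂ (X 0) = X 0 := by simp only [Φ₂, aeval_X]; rfl
  have hΦ₂1 : Φ₂ (X 1) = X 1 := by simp only [Φ₂, aeval_X]; rfl
  have hΦ₂2 : Φ₂ (X 2) = ε f' * X 3 + ε β * X 2 := by simp only [Φ₂, aeval_X]; rfl
  have hΦ₂3 : Φ₂ (X 3) = ε g' * X 3 - ε α * X 2 := by simp only [Φ₂, aeval_X]; rfl
  -- both fix the image of `ε`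
  have hΦε : ∀ (Ψ : MvPolynomial (Fin 4) k →ₐ[k] MvPolynomial (Fin 4) k), Ψ (X 0) = X 0 → Ψ (X 1) = X 1 →
      ∀ r : MvPolynomial (Fin 2) k, Ψ (ε r) = ε r := by
    intro Ψ hΨ0 hΨ1 r
    have h : Ψ.comp ε = ε := by
      refine MvPolynomial.algHom_ext fun i => ?_
      fin_cases i
      · change Ψ (ε (X 0)) = ε (X 0); rw [hε0, hΨ0]
      · change Ψ (ε (X 1)) = ε (X 1); rw [hε1, hΨ1]
    exact DFunLike.congr_fun h r
  have hΦ₁ε := hΦε Φ₁ hΦ₁0 hΦ₁1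
  have hΦ₂ε := hΦε Φ₂ hΦ₂0 hΦ₂1
  have h12 : Φ₁.comp Φ₂ = AlgHom.id k _ := by
    refine MvPolynomial.algHom_ext fun i => ?_
    fin_cases i
    · change Φ₁ (Φ₂ (X 0)) = X 0; rw [hΦ₂0, hΦ₁0]
    · change Φ₁ (Φ₂ (X 1)) = X 1; rw [hΦ₂1, hΦ₁1]
    · change Φ₁ (Φ₂ (X 2)) = X 2
      rw [hΦ₂2, map_add, map_mul, map_mul, hΦ₁ε, hΦ₁ε, hΦ₁3, hΦ₁2]
      linear_combination (X 2 : MvPolynomial (Fin 4) k) * hbez'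
    · change Φ₁ (Φ₂ (X 3)) = X 3
      rw [hΦ₂3, map_sub, map_mul, map_mul, hΦ₁ε, hΦ₁ε, hΦ₁3, hΦ₁2]
      linear_combination (X 3 : MvPolynomial (Fin 4) k) * hbez'
  have h21 : Φ₂.comp Φ₁ = AlgHom.id k _ := by
    refine MvPolynomial.algHom_ext fun i => ?_
    fin_cases i
    · change Φ₂ (Φ₁ (X 0)) = X 0; rw [hΦ₁0, hΦ₂0]
    · change Φ₂ (Φ₁ (X 1)) = X 1; rw [hΦ₁1, hΦ₂1]
    · change Φ₂ (Φ₁ (X 2)) = X 2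
      rw [hΦ₁2, map_sub, map_mul, map_mul, hΦ₂ε, hΦ₂ε, hΦ₂2, hΦ₂3]
      linear_combination (X 2 : MvPolynomial (Fin 4) k) * hbez'
    · change Φ₂ (Φ₁ (X 3)) = X 3
      rw [hΦ₁3, map_add, map_mul, map_mul, hΦ₂ε, hΦ₂ε, hΦ₂2, hΦ₂3]
      linear_combination (X 3 : MvPolynomial (Fin 4) k) * hbez'
  let Φ : MvPolynomial (Fin 4) k ≃ₐ[k] MvPolynomial (Fin 4) k := AlgEquiv.ofAlgHom Φ₁ Φ₂ h12 h21
  have hΦ : ∀ x, Φ x = Φ₁ x := fun _ => rfl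
  have hΦs : ∀ x, Φ.symm x = Φ₂ x := fun _ => rfl
  -- the straightened endomorphism `τ = Φ⁻¹ ∘ σ ∘ Φ`: a RANK-1 translation of the last variable by `ε H`
  let τ : MvPolynomial (Fin 4) k →+* MvPolynomial (Fin 4) k :=
    ((Φ.symm : MvPolynomial (Fin 4) k →+* MvPolynomial (Fin 4) k).comp σ).comp (Φ : MvPolynomial (Fin 4) k →+* MvPolynomial (Fin 4) k)
  have hτ : ∀ x, τ x = Φ₂ (σ (Φ₁ x)) := fun _ => rfl
  have hΦ₁C : ∀ a : k, Φ₁ (C a) = C a := fun a => by rw [← MvPolynomial.algebraMap_eq]; exact Φ₁.commutes a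
  have hΦ₂C : ∀ a : k, Φ₂ (C a) = C a := fun a => by rw [← MvPolynomial.algebraMap_eq]; exact Φ₂.commutes a
  have hτC : ∀ a : k, τ (C a) = C a := fun a => by rw [hτ, hΦ₁C, hC, hΦ₂C]
  have hτ0 : τ (X 0) = X 0 := by rw [hτ, hΦ₁0, h0, hΦ₂0]
  have hτ1 : τ (X 1) = X 1 := by rw [hτ, hΦ₁1, h1, hΦ₂1]
  have hτ2 : τ (X 2) = X 2 := by
    rw [hτ, hΦ₁2, map_sub, map_mul, map_mul, hσε, hσε, h2, h3]
    have : ε g' * (X 2 + ε (H * f')) - ε f' * (X 3 + ε (H * g')) = ε g' * X 2 - ε f' * X 3 := by rw [map_mul, map_mul]; ring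
    rw [this, ← hΦ₁2]
    change Φ₂ (Φ₁ (X 2)) = X 2
    exact DFunLike.congr_fun h21 (X 2)
  have hτ3 : τ (X 3) = X 3 + rename Fin.castSucc (rename (Fin.castLE (by decide : 2 ≤ 3)) H) := by
    have hH : rename Fin.castSucc (rename (Fin.castLE (by decide : 2 ≤ 3)) H) = ε H := by
      rw [rename_rename]; rfl
    rw [hH, hτ, hΦ₁3, map_add, map_mul, map_mul, hσε, hσε, h2, h3]
    have : ε α * (X 2 + ε (H * f')) + ε β * (X 3 + ε (H * g')) = (ε α * X 2 + ε β * X 3) + ε H := by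
      rw [map_mul, map_mul]; linear_combination (ε H) * hbez'
    rw [this, map_add, hΦ₂ε, ← hΦ₁3]
    congr 1
    exact DFunLike.congr_fun h21 (X 3)
  -- the recoordinated chart `e′ = Φ⁻¹ ∘ e` intertwines `g₀` with `τ`
  refine x3Translation_terminal_initial (p := p) hG hq hp (rename (Fin.castLE (by decide : 2 ≤ 3)) H) τ hτC hτ0 hτ1 hτ2 hτ3
    (e.trans (Φ.symm : MvPolynomial (Fin 4) k ≃+* MvPolynomial (Fin 4) k)) (fun t => ?_) h₀
  change Φ.symm (e _) = Φ₂ (σ (Φ₁ (Φ.symm (e t))))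
  rw [he, ← hΦ, Φ.apply_symm_apply, hΦs]

/-- ★ **… hence the rank-2 translation class with principal direction ideal inhabits the research stub at depth 0** (every root decoration;
✓`exists_reachLowerF_of_terminal`). [OURS · L1 W4.5c · class `r = 0` translation, rank 2, principal direction; NOT a statement of the manuscript] -/
theorem exists_reachLowerF_initial_of_translationRankTwo [Finite G] (hG : ∀ g : G, g ∈ Subgroup.zpowers g₀)
    (hq : ∀ g : G, (ρ g).hom ≫ q = q) [IsIntegral X'] [IsLocallyNoetherian X'] [IsAffine X'] [IsAffineHom q]
    {k : Type} [Field k] [CharP k p] (hp : p.Prime) (H f' g' α β : MvPolynomial (Fin 2) k) (hbez : α * f' + β * g' = 1)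
    (σ : MvPolynomial (Fin 4) k →+* MvPolynomial (Fin 4) k) (hC : ∀ a : k, σ (C a) = C a)
    (h0 : σ (X 0) = X 0) (h1 : σ (X 1) = X 1)
    (h2 : σ (X 2) = X 2 + rename (Fin.castLE (by decide : 2 ≤ 4)) (H * f'))
    (h3 : σ (X 3) = X 3 + rename (Fin.castLE (by decide : 2 ≤ 4)) (H * g'))
    (e : Γ(X', ⊤) ≃+* MvPolynomial (Fin 4) k)
    (he : ∀ t : Γ(X', ⊤), e ((ρ g₀⁻¹).hom.appLE ⊤ ⊤ (by rw [Scheme.Hom.preimage_top]) t) = σ (e t))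
    (h₀ : NodeAtlas p (⟨ρ, hq⟩ : ActionOver q G) g₀) (𝔄₀ : NodeAtlasData p (GModel.initial hq h₀).act g₀) :
    ∃ P : ∀ M : GModel p q G ρ g₀, NodeAtlasData p M.act g₀ → Prop,
      P (GModel.initial hq h₀) 𝔄₀ ∧ ∀ (M : GModel p q G ρ g₀) (𝔄 : NodeAtlasData p M.act g₀), P M 𝔄 → ¬ M.Terminal →
        ∃ n : ℕ, TreeF P (fun N 𝔅 => LexLTF N 𝔅 M 𝔄) n M 𝔄 :=
  exists_reachLowerF_of_terminal _ 𝔄₀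
    (translationRankTwo_terminal_initial hG hq hp H f' g' α β hbez σ hC h0 h1 h2 h3 e he h₀)

end Summit.ResolutionOfSingularities.ResolutionOfSingularities.Theorems.WildQuotientResolution.S1.GameFrame.GModel

end
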